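import Literature.NumberTheory.Automorphic.RankinSelbergTorusFinitenessSchwartz
import Literature.NumberTheory.Automorphic.RankinSelbergTorusHolomorphy
import Literature.NumberTheory.Automorphic.RankinSelbergIntegralHolomorphy
import Literature.NumberTheory.Automorphic.RankinSelbergResidueDatum
import Literature.NumberTheory.Automorphic.CuspidalWhittakerGL2
import HarnessLib

/-!
# The unfolding identity of the Rankin–Selberg method on the strip `1 < Re s < 2`

Topic `NumberTheory/Automorphic`; namespace `Literature.NumberTheory.Automorphic`. Proof file (theorems
only). The **basic identity** `I(s; φ̄̃, φ̃, Φ) = C · Ψ(s; W_φ, W̄_φ, Φ)` (Jacquet–Shalika (1981), §4, (4.6);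
Cogdell (2004), §2.3, Thm. 2.1) at COMPLEX points `s`, `1 < Re s < 2`, for a smoothed cusp form in the
honest `L²` model and a real Schwartz–Bruhat `Φ ≥ 0`: the real-point identity
(`RankinSelbergUnfoldingRealPoint`) upgraded by the identity theorem, both sides being holomorphic on
the strip — the Rankin–Selberg integral by `RankinSelbergIntegralHolomorphy`, the Bochner torus integral
by `RankinSelbergTorusHolomorphy` together with the finiteness of the real torus integrals
(`RankinSelbergTorusFinitenessSchwartz`).

* `rankinSelbergTorusIntegralC_ofReal_eq_toReal` — at a real point the Bochner torus integral is the
  real one: `Ψ_ℂ(σ) = Ψ(σ)` when `Ψ(σ) < ∞`;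
* `exists_rankinSelbergIntegral_eq_mul_rankinSelbergTorusIntegralC` (**main**) — there is `C > 0`
  (depending only on the Haar measures) with
  `rankinSelbergIntegral μ' ν_I Φ s (star (S_η f)) (S_η f) = C · rankinSelbergTorusIntegralC νA νK W_φ Φ s`
  for all cuspidal `π`, `f ∈ π`, test functions `η`, real Schwartz–Bruhat `Φ ≥ 0` and `1 < Re s < 2`.

## References

* H. Jacquet, J. A. Shalika, *On Euler products and the classification of automorphic
  representations I*, Amer. J. Math. 103 (1981), §4, (4.6) [JacquetShalikaAJM1981].
* J. W. Cogdell, *Analytic theory of L-functions for GL_n*, in *An Introduction to the Langlands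
  Program* (2004), §2.3 Thm. 2.1 [CogdellAnalyticTheory2004].
-/

noncomputable section

open MeasureTheory Measure NumberField IsDedekindDomain Matrix Set Filter Topology
open scoped ENNReal NNReal ComplexConjugate

namespace Literature.NumberTheory.Automorphic

open Literature.NumberTheory.GaloisRepresentations (ideleGroup)

-- the automorphic quotient carries the tree's Borel σ-algebra, not Mathlib's quotient σ-algebra
attribute [-instance] Quotient.instMeasurableSpace QuotientGroup.measurableSpace

section RealPointC

variable {n : ℕ} {K : Type} [Field K] [NumberField K]
variable [MeasurableSpace (ideleGroup K)] [MeasurableSpace (AdelicGroupData.gl n K).Adelic]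

/-- **At a real point the Bochner torus integral is the real one**: for `Φ ≥ 0`, an a.e. strongly
measurable integrand and `Ψ(σ) < ∞`, `rankinSelbergTorusIntegralC νA νK W Φ σ = (Ψ(σ)).toReal`. [folklore] -/
theorem rankinSelbergTorusIntegralC_ofReal_eq_toReal (νA : Measure (Fin n → ideleGroup K))
    (νK : Measure ↥(maximalCompactAdelic n K)) {W : GL (Fin n) (AdeleRing (𝓞 K) K) → ℂ}
    {Φ : (Fin n → AdeleRing (𝓞 K) K) → ℝ} (hΦ0 : ∀ y, 0 ≤ Φ y) (σ : ℝ)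
    (hm : AEStronglyMeasurable (torusIntegrandC n K W Φ (σ : ℂ)) (νA.prod νK)) :
    rankinSelbergTorusIntegralC n K νA νK W Φ (σ : ℂ) =
      ((rankinSelbergTorusIntegral n K νA νK W Φ σ).toReal : ℂ) := by
  unfold rankinSelbergTorusIntegralC rankinSelbergTorusIntegral
  set G : (Fin n → ideleGroup K) × ↥(maximalCompactAdelic n K) → ℝ := fun p =>
    ‖W (torusPoint n K p)‖ ^ 2 * Φ (lastRow n K (torusPoint n K p)) * torusWeight n K σ p.1 with hG
  have hfun : torusIntegrandC n K W Φ (σ : ℂ) = fun p => ((G p : ℝ) : ℂ) := funext fun p => torusIntegrandC_ofReal σ p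
  have hG0 : ∀ p, 0 ≤ G p := fun p =>
    mul_nonneg (mul_nonneg (sq_nonneg _) (hΦ0 _)) (torusWeight_nonneg σ p.1)
  have hGm : AEStronglyMeasurable G (νA.prod νK) := by
    have h : AEStronglyMeasurable (fun p => (torusIntegrandC n K W Φ (σ : ℂ) p).re) (νA.prod νK) :=
      Complex.continuous_re.comp_aestronglyMeasurable hm
    refine h.congr (Eventually.of_forall fun p => ?_)
    simp only [hfun, Complex.ofReal_re]
  rw [hfun]
  show (∫ p, ((G p : ℝ) : ℂ) ∂(νA.prod νK)) = (((∫⁻ p, ENNReal.ofReal (G p) ∂(νA.prod νK)).toReal : ℝ) : ℂ)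
  rw [← integral_eq_lintegral_of_nonneg_ae (Eventually.of_forall hG0) hGm]
  exact integral_ofReal

end RealPointC

section Identity

variable {n : ℕ} {K : Type} [Field K] [NumberField K]
variable [MeasurableSpace (AdeleRing (𝓞 K) K)] [BorelSpace (AdeleRing (𝓞 K) K)]

-- the house local instances: Borel structures of `GL_n(𝔸_K)` in both spellings and of `𝔸_Kˣ`; none
-- overrides a Mathlib instance
attribute [local instance] adelicBorel borelSpace_adelic locallyCompactSpace_adelic secondCountableTopology_gl_adelic
  glAdeleBorel borelSpace_glAdele borelSpace_ideleGroup

omit [MeasurableSpace (AdeleRing (𝓞 K) K)] [BorelSpace (AdeleRing (𝓞 K) K)] in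
/-- Measurability of the complex torus integrand for continuous `W` and `Φ` with `g ↦ Φ(e_n g)`
measurable (a local copy, in the hypothesis shape produced by `continuous_whittakerCoeff`, of
`measurable_torusIntegrandC` of `RankinSelbergTorusPairEuler`). [folklore] -/
private theorem measurable_torusIntegrandC_aux [MeasurableSpace (ideleGroup K)] [BorelSpace (ideleGroup K)]
    {W : GL (Fin n) (AdeleRing (𝓞 K) K) → ℂ} (hW : Continuous W)
    {Φ : (Fin n → AdeleRing (𝓞 K) K) → ℝ}
    (hΦm : Measurable fun g : GL (Fin n) (AdeleRing (𝓞 K) K) => Φ (lastRow n K g)) (s : ℂ) :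
    Measurable (torusIntegrandC n K W Φ s) := by
  haveI : SecondCountableTopology (GL (Fin n) (AdeleRing (𝓞 K) K)) :=
    secondCountableTopology_generalLinearGroup_adeleRing K (Fin n)
  haveI : SecondCountableTopology (AdelicGroupData.gl n K).Adelic :=
    secondCountableTopology_generalLinearGroup_adeleRing K (Fin n)
  haveI : SecondCountableTopology ↥(maximalCompactAdelic n K) := TopologicalSpace.Subtype.secondCountableTopology _
  haveI := secondCountableTopology_ideleGroup K
  unfold torusIntegrandC
  have hpt : Measurable (torusPoint n K) := continuous_torusPoint.measurable
  refine (Complex.measurable_ofReal.comp (((hW.measurable.comp hpt).norm.pow_const 2).mul (hΦm.comp hpt))).mul ?_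
  have hw : Measurable (torusWeightC n K s) := by
    unfold torusWeightC
    refine Finset.measurable_prod _ fun i _ => ?_
    exact (Complex.measurable_ofReal.comp (measurable_coe_nnreal_real.comp
      ((continuous_ideleNorm_holds K).measurable.comp (measurable_pi_apply i)))).pow_const _
  exact hw.comp measurable_fst

/-- The point `3/2` lies in the closure of the real points of the strip other than itself. [folklore] -/
theorem three_halves_mem_closure_real_strip {T : Set ℂ}
    (hT : ∀ σ : ℝ, 1 < σ → σ < 2 → (σ : ℂ) ∈ T) :
    ((3 / 2 : ℝ) : ℂ) ∈ closure (T \ {((3 / 2 : ℝ) : ℂ)}) := by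
  rw [Metric.mem_closure_iff]
  intro ε hε
  set δ : ℝ := min (ε / 2) (1 / 4) with hδ
  have hδ0 : 0 < δ := lt_min (half_pos hε) (by norm_num)
  have hδ4 : δ ≤ 1 / 4 := min_le_right _ _
  refine ⟨((3 / 2 + δ : ℝ) : ℂ), ⟨hT _ (by linarith) (by linarith), ?_⟩, ?_⟩
  · intro h
    have h' := congrArg Complex.re (Set.mem_singleton_iff.1 h)
    simp only [Complex.ofReal_re] at h'
    linarith
  · rw [Complex.dist_eq, ← Complex.ofReal_sub, Complex.norm_real, Real.norm_eq_abs,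
      show (3 / 2 : ℝ) - (3 / 2 + δ) = -δ by ring, abs_neg, abs_of_pos hδ0]
    exact (min_le_left _ _).trans_lt (half_lt_self hε)

/-- **The unfolding identity of the Rankin–Selberg method on the strip `1 < Re s < 2`.** There is a
constant `C > 0`, depending only on the Haar measures, such that for every cuspidal automorphic
representation `π` of `GL_n(𝔸_K)` (`0 < n`), every `f ∈ π`, every test function `η`, every real
Schwartz–Bruhat `Φ ≥ 0` with `g ↦ Φ(e_n g)` measurable and every `s` with `1 < Re s < 2`:
`I(s; φ̄̃, φ̃, Φ) = C · Ψ(s; W_φ, W̄_φ, Φ)`, i.e.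
`rankinSelbergIntegral μ' ν_I Φ s (star (S_η f)) (S_η f) = C · rankinSelbergTorusIntegralC νA νK W_φ Φ s`
with `φ = invQuot (S_η f)`, `W_φ = whittakerCoeff ν₀ 𝓕_N ψ φ` (Jacquet–Shalika (1981), §4, (4.6); Cogdell
(2004), Thm. 2.1): both sides are holomorphic on the strip and agree at its real points.
[cite: JacquetShalikaAJM1981, §4] [cite: CogdellAnalyticTheory2004, §2.3 Thm. 2.1] -/
theorem exists_rankinSelbergIntegral_eq_mul_rankinSelbergTorusIntegralC (hn : 0 < n)
    (μ' : Measure (AdelicGroupData.gl n K).automorphicQuotient) [(AdelicGroupData.gl n K).IsAutomorphicMeasure μ']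
    (νI : Measure (ideleGroup K)) [νI.IsHaarMeasure]
    (νA : Measure (Fin n → ideleGroup K)) [IsHaarMeasure νA]
    (νK : Measure ↥(maximalCompactAdelic n K)) [IsHaarMeasure νK]
    (ν₀ : Measure ↥(adelicUnipotent n K)) [IsHaarMeasure ν₀] :
    ∃ C : ℝ, 0 < C ∧
      ∀ (P : CuspidalAutomorphicRepGL n K μ') (f : P.1.toSubmodule)
        {η : (AdelicGroupData.gl n K).Adelic → ℝ}, IsTestFunctionGL n K η →
      ∀ {Φ : (Fin n → AdeleRing (𝓞 K) K) → ℝ}, (fun x => (Φ x : ℂ)) ∈ piSchwartzBruhat K (Fin n) →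
        (∀ x, 0 ≤ Φ x) → (Measurable fun g : GL (Fin n) (AdeleRing (𝓞 K) K) => Φ (lastRow n K g)) →
      ∀ {s : ℂ}, 1 < s.re → s.re < 2 →
        rankinSelbergIntegral μ' νI (fun x => (Φ x : ℂ)) s
            (star (smoothedForm η (f : (AdelicGroupData.gl n K).L2 μ')))
            (smoothedForm η (f : (AdelicGroupData.gl n K).L2 μ')) =
          (C : ℂ) * rankinSelbergTorusIntegralC n K νA νK
            (whittakerCoeff ν₀ (unipotentTateDomain n K) (adeleAddChar K)
              (invQuot (AdelicGroupData.gl n K) (smoothedForm η (f : (AdelicGroupData.gl n K).L2 μ'))))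
            Φ s := by
  classical
  haveI : T2Space (GL (Fin n) (AdeleRing (𝓞 K) K)) := t2Space_gl n K
  haveI : LocallyCompactSpace (GL (Fin n) (AdeleRing (𝓞 K) K)) :=
    AdelicGroupData.locallyCompactSpace_generalLinearGroup_adeleRing K (Fin n)
  haveI : SecondCountableTopology (GL (Fin n) (AdeleRing (𝓞 K) K)) :=
    secondCountableTopology_generalLinearGroup_adeleRing K (Fin n)
  haveI hνIR : νI.IsMulRightInvariant := by
    haveI := isInvInvariant_of_isHaarMeasure_ideleGroup (K := K) νI
    infer_instance
  obtain ⟨C, hC0, hCt, hR⟩ :=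
    exists_rankinSelbergIntegral_ofReal_eq_mul_toReal_rankinSelbergTorusIntegral (n := n) (K := K) hn μ' νI νA νK ν₀
  have hCpos : 0 < C.toReal := ENNReal.toReal_pos hC0 hCt
  refine ⟨C.toReal, hCpos, fun P f {η} hη {Φ} hΦS hΦ0 hΦm {s} hs1 hs2 => ?_⟩
  -- the datum
  set φt : (AdelicGroupData.gl n K).automorphicQuotient → ℂ :=
    smoothedForm η (f : (AdelicGroupData.gl n K).L2 μ') with hφt
  set φ : GL (Fin n) (AdeleRing (𝓞 K) K) → ℂ := invQuot (AdelicGroupData.gl n K) φt with hφ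
  have hφtc : Continuous φt := continuous_smoothedForm hη.continuous hη.hasCompactSupport _
  have hφc : Continuous φ := continuous_invQuot_smoothedForm hη.continuous hη.hasCompactSupport _
  have hφd : IsRapidlyDecreasingGL n K φ := isRapidlyDecreasingGL_invQuot_smoothedForm hη (P.2.1 f.2)
  have hφd' : IsRapidlyDecreasingGL n K (invQuot (AdelicGroupData.gl n K) (star φt)) :=
    isRapidlyDecreasingGL_invQuot_star hφd
  set W : GL (Fin n) (AdeleRing (𝓞 K) K) → ℂ :=
    whittakerCoeff ν₀ (unipotentTateDomain n K) (adeleAddChar K) φ with hW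
  have hWc : Continuous W :=
    continuous_whittakerCoeff measurableSet_unipotentTateDomain isCompact_closure_unipotentTateDomain
      (continuous_adeleAddChar (K := K)) hφc
  -- the two holomorphic functions
  set U : Set ℂ := {z : ℂ | 1 < z.re ∧ z.re < 2} with hU
  have hUo : IsOpen U :=
    (isOpen_lt continuous_const Complex.continuous_re).inter (isOpen_lt Complex.continuous_re continuous_const)
  have hUc : IsPreconnected U := by
    have hUeq : U = Complex.reLm ⁻¹' Set.Ioo (1 : ℝ) 2 := by
      ext z
      simp only [hU, Set.mem_setOf_eq, Set.mem_preimage, Set.mem_Ioo, Complex.reLm_coe]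
    rw [hUeq]
    exact ((convex_Ioo (1 : ℝ) 2).linear_preimage Complex.reLm).isPreconnected
  have hI : DifferentiableOn ℂ (fun z => rankinSelbergIntegral μ' νI (fun x => (Φ x : ℂ)) z (star φt) φt) U :=
    differentiableOn_rankinSelbergIntegral (K := K) νI hn μ' hΦS (continuous_star.comp hφtc) hφtc hφd' hφd
  have hm : ∀ z : ℂ, AEStronglyMeasurable (torusIntegrandC n K W Φ z) (νA.prod νK) := fun z =>
    (measurable_torusIntegrandC_aux hWc hΦm z).aestronglyMeasurable
  have hmr : ∀ σ : ℝ, Measurable (torusIntegrand n K W Φ σ) := fun σ => measurable_torusIntegrand hWc hΦm σ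
  have hfin : ∀ σ : ℝ, 1 < σ → σ < 2 → rankinSelbergTorusIntegral n K νA νK W Φ σ ≠ ⊤ := fun σ hσ _ =>
    rankinSelbergTorusIntegral_whittakerCoeff_ne_top_of_mem_piSchwartzBruhat hn νA νK ν₀ P f hη hΦS hΦ0 hΦm hσ
  have hG : DifferentiableOn ℂ (fun z => (C.toReal : ℂ) * rankinSelbergTorusIntegralC n K νA νK W Φ z) U :=
    (differentiableOn_rankinSelbergTorusIntegralC νA νK hΦ0 hm hmr hfin).const_mul _
  -- equality at the real points of the strip
  have hreal : ∀ σ : ℝ, 1 < σ → σ < 2 →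
      rankinSelbergIntegral μ' νI (fun x => (Φ x : ℂ)) (σ : ℂ) (star φt) φt =
        (C.toReal : ℂ) * rankinSelbergTorusIntegralC n K νA νK W Φ (σ : ℂ) := by
    intro σ hσ1 hσ2
    rw [hR P f hη.continuous hη.hasCompactSupport hΦS hΦ0 hΦm hσ1,
      rankinSelbergTorusIntegralC_ofReal_eq_toReal νA νK hΦ0 σ (hm σ), ENNReal.toReal_mul, Complex.ofReal_mul]
  -- the identity theorem
  have hEq := (hI.analyticOnNhd hUo).eqOn_of_preconnected_of_mem_closure (hG.analyticOnNhd hUo) hUc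
    (z₀ := ((3 / 2 : ℝ) : ℂ)) (by simp only [hU, Set.mem_setOf_eq, Complex.ofReal_re]; norm_num)
    (three_halves_mem_closure_real_strip fun σ hσ1 hσ2 => hreal σ hσ1 hσ2)
  exact hEq ⟨hs1, hs2⟩

end Identity

end Literature.NumberTheory.Automorphic
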